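import Summits.QuantumFields.BalabanUV.Beta.GAN24.RowCLevelZero
import Summits.QuantumFields.BalabanUV.Beta.SecondOrderTableLawEnd

/-!
# `BalabanUV.Beta.GAN24.RowCLevelZeroAn1` — binder row G-an2-4 ∕ (CONV-C), the (α-0) chain (`OneCovRecStep`): LOCATED ROW (C) AT LEVEL `0` FOR THE D1
# LITERAL's OWN TABLES — `d = 3`, odd `Lc`, the centred root `ctrOff 4 Lc`, an1's TRUE averaging tables (`mixFFAt`, K-P's border `vh₂SAn1 Lc`), pins
# `cE = Lc⁴`, `cE₂ = Lc⁸`, Wilson table `(8N²)⁻¹ • wsym22 N` (the letters of `RowD1JointEnd.JsRowD1`; `cVH`, `cΛ`, `cB` free)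

NOT IN PRINT; OUR BOOKKEEPING (G-an2-4 formalisation swarm, leaf seat `b2b-balaban-gan24-formalise-leaf-04`, gen 67, journal [LEAF04-G67-INTENT44]; `GAN24/RowCLevelZero`
at `d = 3` with K-P's border lemmas `SecondOrderSocketIdentification.vh₂SAn1_inl_inl ∕ _inr_inr`, `SecondOrderTableLawEnd.locStencil₂_vh₂SAn1 ∕ vh₂SAn1_translate`
BY NAME; module name PROVISIONAL).  HONEST FRAMING (cell contract, verbatim): «discharging `BetaPertH` makes Bałaban's UV stability UNCONDITIONAL — a real
constructive-QFT result; it is NOT the continuum limit and NOT the Clay problem.»  HONEST DEPENDENCY (verbatim): «continuum YM on T⁴ ⇐ BetaPertH ∧ nine spine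
estimates (0/9 proved); BetaPertH ⇐ (D1) ∧ (D4) ∧ CAP+tail; G-an2-4 gates asym, D1 and NE2/3/4.»  0 `def`, 0 `def … : Prop`, 0 cite, 0 sorry; no existing file touched.

WHAT.  With `T̃_j := unitS₂ (sfStep Lc j) (smStep 3 Lc j) (T2RecAt 3 Lc (toSite (ctrOff 4 Lc)) (Lc⁴) cVH cΛ (Lc⁸) cB ((8N²)⁻¹ • wsym22 N) (vh₂SAn1 Lc)
(mixFFAt (toSite (ctrOff 4 Lc)) Lc) j)` (odd `Lc`, `N ≠ 0`): `zmode_member_one_eq_member_zero_an1` — `zmode Lc T̃_1 μ ν (inl α) (inl β) = zmode Lc T̃_0 μ ν (inl α) (inl β)`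
for every pattern; `rowC_level_zero_an1` — (C)_0 of record (the B-frame source `T̃_1 − lin4 (Lc⁸·Lc⁸) K♮_0 Lc T̃_0` has vanishing slot-symmetrised ff zero mode).
HONEST: ONE level of ONE located row, for an1's DEFINED tables at the literal pins; NOT (C) at `j ≥ 1`, NOTHING of (Q-D) ∕ (Q-D-rate) ∕ «T2Shape» ∕ «T2Drift» ∕
(hW, hWall) ∕ D1Tel ∕ D1Rep; NEVER «G-an2-4 closed» as (CONV-C); NOT D1, NOT `BetaPertH`, NOT continuum, NOT Clay.  2026-08-23.
-/

noncomputable section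

open Finset
open scoped BigOperators
open Literature.MathematicalPhysics.QuantumFieldTheory
open Literature.MathematicalPhysics.QuantumFieldTheory.Balaban1983to89
open Literature.MathematicalPhysics.QuantumFieldTheory.Balaban1983to89.Beta
open AffineAveraging (Site box toSite)
open AveragingContoursRooted (ctrOff ctrOff_mem_box)
open ExpKernelCalculus (MKer shiftK)
open OneStepResolventKernel (Fib)
open OneStepKernelFamily (KInvStep)
open WilsonVertex2Sym (wsym22)
open AveragingMixedJetTables (mixFFAt)
open Summit.QuantumFields.BalabanUV.Beta.HessKerDressedUnits (unitK)
open Summit.QuantumFields.BalabanUV.Beta.SecondOrderUnits (unitS₂)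
open Summit.QuantumFields.BalabanUV.Beta.SpineRooted (T2RecAt)
open Summit.QuantumFields.BalabanUV.Beta.SecondOrderSocketIdentification (vh₂SAn1 vh₂SAn1_inl_inl vh₂SAn1_inr_inr)
open Summit.QuantumFields.BalabanUV.Beta.SecondOrderTableLawEnd (locStencil₂_vh₂SAn1 vh₂SAn1_translate)
open Summit.QuantumFields.BalabanUV.Beta.GAN24.CombesThomas (sfStep smStep)
open Summit.QuantumFields.BalabanUV.Beta.GAN24.T2RecursionAffine (lin4)
open Summit.QuantumFields.BalabanUV.Beta.GAN24.BiStencilZeroMode (zmode)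
open Summit.QuantumFields.BalabanUV.Beta.GAN24.RowCLevelZero (zmode_member_one_eq_member_zero rowC_level_zero)

namespace Summit.QuantumFields.BalabanUV.Beta.GAN24.RowCLevelZeroAn1

variable {Lc : ℕ} [NeZero Lc]

/-- NOT IN PRINT; OUR BOOKKEEPING.  **(C)_0 FOR THE D1 LITERAL's TABLES, EVERY PATTERN** (`d = 3`, odd `Lc`, centred root, an1's true mixed table, K-P's border
`vh₂SAn1 Lc`, `cE = Lc⁴`, `cE₂ = Lc⁸`, `Tc = (8N²)⁻¹ • wsym22 N`, `N ≠ 0`; `cVH cΛ cB` free). -/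
theorem zmode_member_one_eq_member_zero_an1 (hodd : Odd Lc) {N : ℕ} (hN : N ≠ 0) (cVH cΛ cB : ℝ) (μ ν α β : Fin (3 + 1)) :
    zmode Lc (unitS₂ (sfStep Lc (0 + 1)) (smStep 3 Lc (0 + 1))
        (T2RecAt 3 Lc (toSite (ctrOff (3 + 1) Lc)) ((Lc : ℝ) ^ 4) cVH cΛ ((Lc : ℝ) ^ 8) cB ((8 * (N : ℝ) ^ 2)⁻¹ • wsym22 N) (vh₂SAn1 Lc)
          (mixFFAt (toSite (ctrOff (3 + 1) Lc)) Lc) (0 + 1))) μ ν (Sum.inl α) (Sum.inl β)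
      = zmode Lc (unitS₂ (sfStep Lc 0) (smStep 3 Lc 0)
        (T2RecAt 3 Lc (toSite (ctrOff (3 + 1) Lc)) ((Lc : ℝ) ^ 4) cVH cΛ ((Lc : ℝ) ^ 8) cB ((8 * (N : ℝ) ^ 2)⁻¹ • wsym22 N) (vh₂SAn1 Lc)
          (mixFFAt (toSite (ctrOff (3 + 1) Lc)) Lc) 0)) μ ν (Sum.inl α) (Sum.inl β) := by
  have hLc : 1 ≤ Lc := by have := hodd.pos; omega
  exact zmode_member_one_eq_member_zero (d := 3) (by norm_num) hLc (ctrOff_mem_box (by omega)) hN ((Lc : ℝ) ^ 4) cVH cΛ ((Lc : ℝ) ^ 8) cB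
    (by ring) (by norm_num) (fun κ u κ' u' x z α β => vh₂SAn1_inl_inl κ u κ' u' x z α β)
    (fun κ u κ' u' x z μ ν => vh₂SAn1_inr_inr κ u κ' u' x z μ ν) (locStencil₂_vh₂SAn1 hodd)
    (fun κ u κ' u' t => vh₂SAn1_translate hLc κ u κ' u' t) μ ν α β

/-- NOT IN PRINT; OUR BOOKKEEPING.  **LOCATED ROW (C) AT LEVEL `0`, OF RECORD, FOR THE D1 LITERAL's TABLES**: the B-frame source of the first comb step has
vanishing slot-symmetrised field–field zero mode on every pattern. -/
theorem rowC_level_zero_an1 (hodd : Odd Lc) {N : ℕ} (hN : N ≠ 0) (cVH cΛ cB : ℝ) (κ κ' κ₁ κ₂ : Fin (3 + 1)) :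
    zmode Lc ((unitS₂ (sfStep Lc (0 + 1)) (smStep 3 Lc (0 + 1))
              (T2RecAt 3 Lc (toSite (ctrOff (3 + 1) Lc)) ((Lc : ℝ) ^ 4) cVH cΛ ((Lc : ℝ) ^ 8) cB ((8 * (N : ℝ) ^ 2)⁻¹ • wsym22 N) (vh₂SAn1 Lc)
                (mixFFAt (toSite (ctrOff (3 + 1) Lc)) Lc) (0 + 1)))
            - lin4 (((Lc : ℝ) ^ 8) * (Lc : ℝ) ^ (2 * (3 + 1))) (unitK (sfStep Lc 0) (smStep 3 Lc 0) (KInvStep (d := 3) Lc 0)) Lc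
              (unitS₂ (sfStep Lc 0) (smStep 3 Lc 0)
                (T2RecAt 3 Lc (toSite (ctrOff (3 + 1) Lc)) ((Lc : ℝ) ^ 4) cVH cΛ ((Lc : ℝ) ^ 8) cB ((8 * (N : ℝ) ^ 2)⁻¹ • wsym22 N) (vh₂SAn1 Lc)
                  (mixFFAt (toSite (ctrOff (3 + 1) Lc)) Lc) 0))) κ κ' (Sum.inl κ₁) (Sum.inl κ₂)
        + zmode Lc ((unitS₂ (sfStep Lc (0 + 1)) (smStep 3 Lc (0 + 1))
              (T2RecAt 3 Lc (toSite (ctrOff (3 + 1) Lc)) ((Lc : ℝ) ^ 4) cVH cΛ ((Lc : ℝ) ^ 8) cB ((8 * (N : ℝ) ^ 2)⁻¹ • wsym22 N) (vh₂SAn1 Lc)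
                (mixFFAt (toSite (ctrOff (3 + 1) Lc)) Lc) (0 + 1)))
            - lin4 (((Lc : ℝ) ^ 8) * (Lc : ℝ) ^ (2 * (3 + 1))) (unitK (sfStep Lc 0) (smStep 3 Lc 0) (KInvStep (d := 3) Lc 0)) Lc
              (unitS₂ (sfStep Lc 0) (smStep 3 Lc 0)
                (T2RecAt 3 Lc (toSite (ctrOff (3 + 1) Lc)) ((Lc : ℝ) ^ 4) cVH cΛ ((Lc : ℝ) ^ 8) cB ((8 * (N : ℝ) ^ 2)⁻¹ • wsym22 N) (vh₂SAn1 Lc)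
                  (mixFFAt (toSite (ctrOff (3 + 1) Lc)) Lc) 0))) κ' κ (Sum.inl κ₁) (Sum.inl κ₂)
      = 0 := by
  have hLc : 1 ≤ Lc := by have := hodd.pos; omega
  exact rowC_level_zero (d := 3) (by norm_num) hLc (ctrOff_mem_box (by omega)) hN ((Lc : ℝ) ^ 4) cVH cΛ ((Lc : ℝ) ^ 8) cB
    (by ring) (by norm_num) (fun κ u κ' u' x z α β => vh₂SAn1_inl_inl κ u κ' u' x z α β)
    (fun κ u κ' u' x z μ ν => vh₂SAn1_inr_inr κ u κ' u' x z μ ν) (locStencil₂_vh₂SAn1 hodd)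
    (fun κ u κ' u' t => vh₂SAn1_translate hLc κ u κ' u' t) κ κ' κ₁ κ₂

end Summit.QuantumFields.BalabanUV.Beta.GAN24.RowCLevelZeroAn1

end
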